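import Mathlib
import HarnessLib
import Summits.Ventures.LatticeQCDFlow.Exactness.SphereLOFlowEntropyFloor
/-!
# The static germ of the block fluctuations: `a_j ≥ (c²/2)·s_j − (8|κ|³υ³/(d−1)²)·|I_j|·c³` with `s_j` the mean absolute deviation of the corridor average of the STATIC block term `V_j = Σ_{n∈I_j} v_n` — an explicit extensive floor for small flow times
HONEST FRAMING: exact (Metropolis-corrected) sampling algorithms for lattice gauge theory;
figures of merit are autocorrelation/cost numbers at stated couplings and volumes; no
continuum-physics claim.

Venture `LatticeQCDFlow` (cell pub-lqcd), topic `Exactness`; FANOUT row 7 (`s0-cpn-null`).  NEW WORK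
of the cell over this lineage's `Exactness/SphereLOFlowEntropyFloor.lean` (the extensive floor
`KL ≥ Σ_j log(1 + a_j²/8) − |Λ|·(12κ²υ²/(d−1))·c²·τ_m(c)`, `a_j = ∫|A_C h_j − ∫h_j| dπ̄` the fluctuations
of the LOCALIZED block terms `h_j = Σ_{n∈I_j} g_n`) and `Exactness/SphereLOFlowLocalizedSiteTerms.lean`;
nothing is cited as a fact.  The point: the `a_j` are controlled FROM BELOW by a STATIC quantity —
to leading order in the flow time `g_n = −(c²/2)·v_n + O(c³)`, `v_n(y) = (2κ²/(d−1))‖p_n(y)‖²` the site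
term of the residual slope `V₀`, so `a_j ≥ (c²/2)·s_j − O(|I_j|c³)` with `s_j = ∫|A_C V_j − ∫V_j dπ̄| dπ̄`,
`V_j = Σ_{n∈I_j} v_n`: a flow-free functional of the a-priori product measure, reading only the
couplings within coupling distance `m + 2` of the block, and `> 0` as soon as `A_C V_j` is non-constant
(`SphereLOFlowEntropyFloor.integral_abs_coordAvg_sub_pos_of_ne`).

## Content

* §1 `norm_loFlow_sub_self_le` — the exact LO flow moves every site at speed `≤ σ = |κ|υ/(d−1)`:
  `‖Φ_{0→u}(x)_n − x_n‖ ≤ σ·u` on `Ω̃` for `0 ≤ u ≤ |T| + 1`; `loCarreSite_piecewise_eq` (`v_n` reads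
  only `N n`); **`abs_loLocalTerm_add_germ_le`** — `|g_n(ω) + (c²/2)·v_n(ω)| ≤ (4|κ|³υ³/(d−1)²)·c³`.
* §2 `abs_coordAvg_le_of_abs_le`; **`germ_le_blockFluctuation`** — `(c²/2)·s_j − (8|κ|³υ³/(d−1)²)|I_j|c³ ≤ a_j`.
* §3 **`sum_log_one_add_sq_germ_sub_le_klDiv_map_loFlow`** — THE FLOOR WITH THE STATIC GERM:
  `Σ_{j∈T} log(1 + (max 0 ((c²/2)s_j − (8|κ|³υ³/(d−1)²)|I_j|c³))²/8) − |Λ|·(12κ²υ²/(d−1))·c²·τ_m(c) ≤ KL`.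

NOT CLAIMED: a lower bound on `s_j` (static, model- and block-specific; positive iff `A_C V_j` is
non-constant — not evaluated here); optimality of the `c³` constant; numbers.
-/

noncomputable section

namespace Summit.Ventures.LatticeQCDFlow.Exactness

open Function Set Metric MeasureTheory NormedSpace InnerProductSpace InformationTheory
open scoped RealInnerProductSpace Topology Nat Classical

variable {Λ : Type*} {E : Type*} [NormedAddCommGroup E] [InnerProductSpace ℝ E]
  [FiniteDimensional ℝ E] [Fintype Λ] [DecidableEq Λ]

/-! ## §1 The germ of one localized site term -/

section Germ

variable {U : Λ → Λ → (E →L[ℝ] E)} {T : ℝ}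

/-- **The exact LO flow moves every site at speed at most `σ = |κ|υ/(d−1)`**: for `x ∈ Ω̃` and
`0 ≤ u ≤ |T| + 1`, `‖Φ_{0→u}(x)_n − x_n‖ ≤ (|κ|υ/(d−1))·u` (the velocity is Lüscher's LO generator
`(κ/(d−1))·p_n`, `‖p_n‖ ≤ υ`; mean value inequality). -/
theorem norm_loFlow_sub_self_le (hU0 : ∀ n, U n n = 0)
    (hUadj : ∀ m n (v w : E), ⟪U m n v, w⟫ = ⟪v, U n m w⟫) (hd : 2 ≤ Module.finrank ℝ E)
    (κ S₀ : ℝ) {υ : ℝ} (hυ : ∀ k, ∑ m, ‖U k m‖ ≤ υ) {x : Λ → E} (hx : ∀ n, ‖x n‖ = 1)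
    {u : ℝ} (hu0 : 0 ≤ u) (hu : u ≤ |T| + 1) (n : Λ) :
    ‖sphereTDFlow (G := fun _ : ℝ => loFlowAction κ S₀ U)
          (contDiff_const_family (contDiff_loFlowAction U κ S₀)) T 0 u x n - x n‖ ≤
      |κ| * υ / ((Module.finrank ℝ E : ℝ) - 1) * u := by
  have hd1 : (0 : ℝ) < (Module.finrank ℝ E : ℝ) - 1 := by
    have : (2 : ℝ) ≤ Module.finrank ℝ E := by exact_mod_cast hd
    linarith
  set Φ : ℝ → Λ → E := fun s => sphereTDFlow (G := fun _ : ℝ => loFlowAction κ S₀ U)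
    (contDiff_const_family (contDiff_loFlowAction U κ S₀)) T 0 s x with hΦ
  -- the `n`-th component as a curve, its derivative and the speed bound on `[0, u]`
  have hderiv : ∀ s ∈ Icc 0 u, HasDerivWithinAt (fun s => Φ s n)
      (-siteGrad n (loFlowAction κ S₀ U) (Φ s)) (Icc 0 u) s := by
    intro s hs
    have hs' : |s| ≤ |T| + 1 := by rw [abs_of_nonneg hs.1]; exact hs.2.trans hu
    have h := hasDerivAt_sphereTDFlow (G := fun _ : ℝ => loFlowAction κ S₀ U)
      (contDiff_const_family (contDiff_loFlowAction U κ S₀)) 0 hx hs' (T := T)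
    exact ((hasDerivAt_pi.1 h) n).hasDerivWithinAt
  have hbound : ∀ s ∈ Ico 0 u, ‖-siteGrad n (loFlowAction κ S₀ U) (Φ s)‖ ≤
      |κ| * υ / ((Module.finrank ℝ E : ℝ) - 1) := by
    intro s _
    have h1 : ∀ k, ‖Φ s k‖ = 1 := fun k => norm_sphereTDFlow_eq_one _ 0 hx s k
    have hgen : -siteGrad n (loFlowAction κ S₀ U) (Φ s) = loGenerator κ S₀ U n (Φ s) := rfl
    rw [hgen, loGenerator_eq hU0 hUadj hd κ S₀ (h1 n), norm_smul, Real.norm_eq_abs, abs_div,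
      abs_of_pos hd1]
    calc |κ| / ((Module.finrank ℝ E : ℝ) - 1) * ‖tangentKick (localField U n (Φ s)) (Φ s n)‖
        ≤ |κ| / ((Module.finrank ℝ E : ℝ) - 1) * υ :=
          mul_le_mul_of_nonneg_left ((norm_tangentKick_localField_le U h1 n).trans (hυ n))
            (div_nonneg (abs_nonneg _) hd1.le)
      _ = |κ| * υ / ((Module.finrank ℝ E : ℝ) - 1) := by ring
  have h := norm_image_sub_le_of_norm_deriv_le_segment' hderiv hbound u ⟨hu0, le_rfl⟩
  have h0 : Φ 0 n = x n := by simp only [hΦ, sphereTDFlow_self]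
  rwa [h0, sub_zero] at h

omit [FiniteDimensional ℝ E] [DecidableEq Λ] in
/-- The site term `v_n` reads only the sites of `N n`: gluing outside `nball N (m+1) n ⊇ N n` does not
change it. -/
theorem loCarreSite_piecewise_eq (hd : 2 ≤ Module.finrank ℝ E) (κ : ℝ) {υ : ℝ}
    (hυ : ∀ k, ∑ m, ‖U k m‖ ≤ υ) {x e : Λ → E} (hx : ∀ n, ‖x n‖ = 1) (he : ∀ n, ‖e n‖ = 1)
    (n : Λ) (m : ℕ) :
    2 * κ ^ 2 / ((Module.finrank ℝ E : ℝ) - 1) *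
        ‖tangentKick (localField U n ((nball (fun k => insert k (couplingNbhd U k)) (m + 1) n).piecewise x e))
          ((nball (fun k => insert k (couplingNbhd U k)) (m + 1) n).piecewise x e n)‖ ^ 2 =
      2 * κ ^ 2 / ((Module.finrank ℝ E : ℝ) - 1) * ‖tangentKick (localField U n x) (x n)‖ ^ 2 := by
  set N : Λ → Set Λ := fun k => insert k (couplingNbhd U k) with hN
  have hz : ∀ k, ‖(nball N (m + 1) n).piecewise x e k‖ = 1 := by
    intro k
    by_cases hk : k ∈ nball N (m + 1) n
    · rw [Set.piecewise_eq_of_mem _ _ _ hk]; exact hx k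
    · rw [Set.piecewise_eq_of_notMem _ _ _ hk]; exact he k
  have hNsub : N n ⊆ nball N (m + 1) n :=
    (subset_nball_one n).trans (nball_mono (Nat.le_add_left 1 m) n)
  have h := abs_loCarreSite_sub_le hd κ hυ n hz hx le_rfl (η := 0) fun j hj => by
    rw [Set.piecewise_eq_of_mem _ _ _ (hNsub hj), sub_self, norm_zero]
  rw [mul_zero] at h
  exact sub_eq_zero.1 (abs_nonpos_iff.1 h)

set_option maxHeartbeats 400000 in
/-- **THE GERM OF A LOCALIZED SITE TERM: `|g_n(ω) + (c²/2)·v_n(ω)| ≤ (4|κ|³υ³/(d−1)²)·c³`** for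
`0 ≤ c ≤ |T| + 1` (speed `≤ |κ|υ/(d−1)` of the flow times the read-set modulus `12κ²υ²/(d−1)` of `v_n`,
integrated against `u du`): to leading order `g_n` is `−(c²/2)` times the STATIC site term `v_n`. -/
theorem abs_loLocalTerm_add_germ_le (hU0 : ∀ n, U n n = 0)
    (hUadj : ∀ m n (v w : E), ⟪U m n v, w⟫ = ⟪v, U n m w⟫) (hd : 2 ≤ Module.finrank ℝ E)
    (κ S₀ : ℝ) {υ : ℝ} (hυ : ∀ k, ∑ m, ‖U k m‖ ≤ υ) {e : Λ → E} (he : ∀ n, ‖e n‖ = 1) (m : ℕ)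
    {c : ℝ} (hc0 : 0 ≤ c) (hc : c ≤ |T| + 1)
    {g : Λ → (Λ → sphere (0 : E) 1) → ℝ}
    (hg : ∀ n ω, g n ω = -∫ u in (0 : ℝ)..c, u * (2 * κ ^ 2 / ((Module.finrank ℝ E : ℝ) - 1) *
      ‖tangentKick (localField U n (sphereTDFlow (G := fun _ : ℝ => loFlowAction κ S₀ U)
          (contDiff_const_family (contDiff_loFlowAction U κ S₀)) T 0 u
          ((nball (fun k => insert k (couplingNbhd U k)) (m + 1) n).piecewise
            (fun i => ((ω i : sphere (0 : E) 1) : E)) e)))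
        (sphereTDFlow (G := fun _ : ℝ => loFlowAction κ S₀ U)
          (contDiff_const_family (contDiff_loFlowAction U κ S₀)) T 0 u
          ((nball (fun k => insert k (couplingNbhd U k)) (m + 1) n).piecewise
            (fun i => ((ω i : sphere (0 : E) 1) : E)) e) n)‖ ^ 2))
    (n : Λ) (ω : Λ → sphere (0 : E) 1) :
    |g n ω + c ^ 2 / 2 * (2 * κ ^ 2 / ((Module.finrank ℝ E : ℝ) - 1) *
        ‖tangentKick (localField U n (fun i => (ω i : E))) ((fun i => (ω i : E)) n)‖ ^ 2)| ≤
      4 * |κ| ^ 3 * υ ^ 3 / ((Module.finrank ℝ E : ℝ) - 1) ^ 2 * c ^ 3 := by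
  set N : Λ → Set Λ := fun k => insert k (couplingNbhd U k) with hN
  set x : Λ → E := fun i => (ω i : E) with hxdef
  have hx : ∀ i, ‖x i‖ = 1 := norm_sphereConfig_eq_one ω
  set z : Λ → E := (nball N (m + 1) n).piecewise x e with hzdef
  have hz : ∀ k, ‖z k‖ = 1 := by
    intro k
    by_cases hk : k ∈ nball N (m + 1) n
    · simp only [hzdef]; rw [Set.piecewise_eq_of_mem _ _ _ hk]; exact hx k
    · simp only [hzdef]; rw [Set.piecewise_eq_of_notMem _ _ _ hk]; exact he k
  have hd1 : (0 : ℝ) < (Module.finrank ℝ E : ℝ) - 1 := by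
    have : (2 : ℝ) ≤ Module.finrank ℝ E := by exact_mod_cast hd
    linarith
  have hυ0 : 0 ≤ υ := le_trans (Finset.sum_nonneg fun m _ => norm_nonneg _) (hυ n)
  set Φ : ℝ → Λ → E := fun u => sphereTDFlow (G := fun _ : ℝ => loFlowAction κ S₀ U)
    (contDiff_const_family (contDiff_loFlowAction U κ S₀)) T 0 u z with hΦ
  set w : (Λ → E) → ℝ := fun y =>
    2 * κ ^ 2 / ((Module.finrank ℝ E : ℝ) - 1) * ‖tangentKick (localField U n y) (y n)‖ ^ 2 with hw
  set L : ℝ := 12 * κ ^ 2 * υ ^ 2 / ((Module.finrank ℝ E : ℝ) - 1) *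
    (|κ| * υ / ((Module.finrank ℝ E : ℝ) - 1)) with hL
  -- the static value: `v_n(z) = v_n(x)`
  have hstat : w z = w x := by
    simp only [hw, hzdef]
    exact loCarreSite_piecewise_eq hd κ hυ hx he n m
  -- pointwise germ error along the flow
  have hpt : ∀ u ∈ Set.Icc 0 c, |u * w (Φ u) - u * w z| ≤ u * (L * u) := by
    intro u hu
    rw [← mul_sub, abs_mul, abs_of_nonneg hu.1]
    refine mul_le_mul_of_nonneg_left ?_ hu.1
    have hΦ1 : ∀ k, ‖Φ u k‖ = 1 := fun k => norm_sphereTDFlow_eq_one _ 0 hz u k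
    have hdisp : ∀ j ∈ insert n (couplingNbhd U n), ‖Φ u j - z j‖ ≤
        |κ| * υ / ((Module.finrank ℝ E : ℝ) - 1) * u := fun j _ =>
      norm_loFlow_sub_self_le hU0 hUadj hd κ S₀ hυ hz hu.1 (hu.2.trans hc) j (T := T)
    have h := abs_loCarreSite_sub_le hd κ hυ n hΦ1 hz
      (mul_nonneg (div_nonneg (by positivity) hd1.le) hu.1) hdisp
    calc |w (Φ u) - w z| ≤ 12 * κ ^ 2 * υ ^ 2 / ((Module.finrank ℝ E : ℝ) - 1) *
          (|κ| * υ / ((Module.finrank ℝ E : ℝ) - 1) * u) := h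
      _ = L * u := by rw [hL]; ring
  have hwc : Continuous fun u : ℝ => w (Φ u) := continuous_loCarreSite_loFlow (U := U) κ S₀ n z (T := T)
  have hfi : IntervalIntegrable (fun u => u * w (Φ u)) volume 0 c :=
    (continuous_id.mul hwc).intervalIntegrable _ _
  have hgi : IntervalIntegrable (fun u => u * w z) volume 0 c :=
    (continuous_id.mul continuous_const).intervalIntegrable _ _
  -- `g_n(ω) + (c²/2) v_n(x) = −∫_0^c u (w(Φ_u z) − w z) du`
  have hgn : g n ω = -∫ u in (0 : ℝ)..c, u * w (Φ u) := hg n ω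
  have hconst : ∫ u in (0 : ℝ)..c, u * w z = c ^ 2 / 2 * w z := by
    rw [intervalIntegral.integral_mul_const, integral_id]; ring
  have hrew : g n ω + c ^ 2 / 2 * w x = -((∫ u in (0 : ℝ)..c, u * w (Φ u)) - ∫ u in (0 : ℝ)..c, u * w z) := by
    rw [hgn, hconst, hstat]; ring
  change |g n ω + c ^ 2 / 2 * w x| ≤ 4 * |κ| ^ 3 * υ ^ 3 / ((Module.finrank ℝ E : ℝ) - 1) ^ 2 * c ^ 3
  rw [hrew, abs_neg, ← intervalIntegral.integral_sub hfi hgi]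
  have h1 : |∫ u in (0 : ℝ)..c, (u * w (Φ u) - u * w z)| ≤ ∫ u in (0 : ℝ)..c, |u * w (Φ u) - u * w z| :=
    intervalIntegral.abs_integral_le_integral_abs hc0
  have h2 : ∫ u in (0 : ℝ)..c, |u * w (Φ u) - u * w z| ≤ ∫ u in (0 : ℝ)..c, u * (L * u) := by
    refine intervalIntegral.integral_mono_on hc0 ?_ ?_ hpt
    · exact ((continuous_id.mul hwc).sub (continuous_id.mul continuous_const)).abs.intervalIntegrable _ _
    · exact (continuous_id.mul (continuous_const.mul continuous_id)).intervalIntegrable _ _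
  have h3 : ∫ u in (0 : ℝ)..c, u * (L * u) = L * (c ^ 3 / 3) := by
    have e : (fun u : ℝ => u * (L * u)) = fun u => u ^ 2 * L := by funext u; ring
    rw [e, intervalIntegral.integral_mul_const, integral_pow]; ring
  calc |∫ u in (0 : ℝ)..c, (u * w (Φ u) - u * w z)| ≤ L * (c ^ 3 / 3) := by linarith
    _ = 4 * |κ| ^ 3 * υ ^ 3 / ((Module.finrank ℝ E : ℝ) - 1) ^ 2 * c ^ 3 := by
        rw [hL]
        have hκ : κ ^ 2 = |κ| ^ 2 := (sq_abs κ).symm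
        rw [hκ]
        field_simp
        ring

end Germ

/-! ## §2 From the germ to the block fluctuation -/

section CoordAvgBound

variable {ι : Type*} [Fintype ι] [DecidableEq ι] {X : Type*} [MeasurableSpace X]
  (μ : Measure X) [IsProbabilityMeasure μ]

/-- `|G| ≤ ρ` pointwise ⇒ `|A_s G| ≤ ρ` pointwise (the coordinate average is an average). -/
theorem abs_coordAvg_le_of_abs_le (s : Finset ι) {G : (ι → X) → ℝ} {ρ : ℝ} (hG : ∀ ω, |G ω| ≤ ρ)
    (ω : ι → X) : |coordAvg μ s G ω| ≤ ρ := by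
  unfold coordAvg
  have h := norm_integral_le_of_norm_le_const (μ := Measure.pi (fun _ : ι => μ))
    (f := fun ω' : ι → X => G (s.piecewise ω' ω)) (C := ρ) (ae_of_all _ fun ω' => by
      rw [Real.norm_eq_abs]; exact hG _)
  rwa [probReal_univ, mul_one, Real.norm_eq_abs] at h

end CoordAvgBound

section Block

variable [MeasurableSpace E] [BorelSpace E] [Nontrivial E] {U : Λ → Λ → (E →L[ℝ] E)} {T : ℝ}

set_option maxHeartbeats 400000 in
/-- **THE STATIC GERM CONTROLS THE BLOCK FLUCTUATION FROM BELOW**: for a finite set of sites `I`,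
`h = Σ_{n∈I} g_n`, `V = Σ_{n∈I} v_n` and any corridor set `C` (`0 ≤ c ≤ |T| + 1`):
`(c²/2)·∫|A_C V − ∫V dπ̄| dπ̄ − 2·|I|·(4|κ|³υ³/(d−1)²)·c³ ≤ ∫|A_C h − ∫h dπ̄| dπ̄`. -/
theorem germ_le_blockFluctuation (hU0 : ∀ n, U n n = 0)
    (hUadj : ∀ m n (v w : E), ⟪U m n v, w⟫ = ⟪v, U n m w⟫) (hd : 2 ≤ Module.finrank ℝ E)
    (κ S₀ : ℝ) {υ : ℝ} (hυ : ∀ k, ∑ m, ‖U k m‖ ≤ υ) {e : Λ → E} (he : ∀ n, ‖e n‖ = 1) (m : ℕ)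
    {c : ℝ} (hc0 : 0 ≤ c) (hc : c ≤ |T| + 1)
    {g : Λ → (Λ → sphere (0 : E) 1) → ℝ}
    (hg : ∀ n ω, g n ω = -∫ u in (0 : ℝ)..c, u * (2 * κ ^ 2 / ((Module.finrank ℝ E : ℝ) - 1) *
      ‖tangentKick (localField U n (sphereTDFlow (G := fun _ : ℝ => loFlowAction κ S₀ U)
          (contDiff_const_family (contDiff_loFlowAction U κ S₀)) T 0 u
          ((nball (fun k => insert k (couplingNbhd U k)) (m + 1) n).piecewise
            (fun i => ((ω i : sphere (0 : E) 1) : E)) e)))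
        (sphereTDFlow (G := fun _ : ℝ => loFlowAction κ S₀ U)
          (contDiff_const_family (contDiff_loFlowAction U κ S₀)) T 0 u
          ((nball (fun k => insert k (couplingNbhd U k)) (m + 1) n).piecewise
            (fun i => ((ω i : sphere (0 : E) 1) : E)) e) n)‖ ^ 2))
    (I C : Finset Λ) :
    c ^ 2 / 2 * (∫ ω, |coordAvg (uniformSphere (volume : Measure E)) C (fun ω => ∑ n ∈ I,
          2 * κ ^ 2 / ((Module.finrank ℝ E : ℝ) - 1) *
            ‖tangentKick (localField U n (fun i => ((ω i : sphere (0 : E) 1) : E))) (ω n : E)‖ ^ 2) ω -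
          ∫ ω', (∑ n ∈ I, 2 * κ ^ 2 / ((Module.finrank ℝ E : ℝ) - 1) *
            ‖tangentKick (localField U n (fun i => ((ω' i : sphere (0 : E) 1) : E))) (ω' n : E)‖ ^ 2)
            ∂Measure.pi (fun _ : Λ => uniformSphere (volume : Measure E))|
          ∂Measure.pi (fun _ : Λ => uniformSphere (volume : Measure E))) -
        2 * (I.card * (4 * |κ| ^ 3 * υ ^ 3 / ((Module.finrank ℝ E : ℝ) - 1) ^ 2 * c ^ 3)) ≤
      ∫ ω, |coordAvg (uniformSphere (volume : Measure E)) C (fun ω => ∑ n ∈ I, g n ω) ω -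
          ∫ ω', (∑ n ∈ I, g n ω') ∂Measure.pi (fun _ : Λ => uniformSphere (volume : Measure E))|
        ∂Measure.pi (fun _ : Λ => uniformSphere (volume : Measure E)) := by
  set μ : Measure (Λ → sphere (0 : E) 1) := Measure.pi (fun _ : Λ => uniformSphere (volume : Measure E))
    with hμ
  set v : Λ → (Λ → sphere (0 : E) 1) → ℝ := fun n ω => 2 * κ ^ 2 / ((Module.finrank ℝ E : ℝ) - 1) *
    ‖tangentKick (localField U n (fun i => ((ω i : sphere (0 : E) 1) : E))) (ω n : E)‖ ^ 2 with hv
  set V : (Λ → sphere (0 : E) 1) → ℝ := fun ω => ∑ n ∈ I, v n ω with hV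
  set h : (Λ → sphere (0 : E) 1) → ℝ := fun ω => ∑ n ∈ I, g n ω with hh
  set ρ : ℝ := I.card * (4 * |κ| ^ 3 * υ ^ 3 / ((Module.finrank ℝ E : ℝ) - 1) ^ 2 * c ^ 3) with hρ
  have hgc : ∀ n, Continuous (g n) := continuous_loLocalTerm (U := U) κ S₀ e m c hg (T := T)
  have hvc : ∀ n, Continuous (v n) := fun n => (continuous_loCarreSite (U := U) κ n).comp continuous_sphereConfig
  have hhc : Continuous h := continuous_finsetSum _ fun n _ => hgc n
  have hVc : Continuous V := continuous_finsetSum _ fun n _ => hvc n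
  -- the germ, summed over the block: `|h + (c²/2) V| ≤ ρ`
  have hgerm : ∀ ω, |h ω + c ^ 2 / 2 * V ω| ≤ ρ := by
    intro ω
    have e1 : h ω + c ^ 2 / 2 * V ω = ∑ n ∈ I, (g n ω + c ^ 2 / 2 * v n ω) := by
      simp only [hh, hV, Finset.mul_sum, Finset.sum_add_distrib]
    rw [e1]
    refine (Finset.abs_sum_le_sum_abs _ _).trans ?_
    calc ∑ n ∈ I, |g n ω + c ^ 2 / 2 * v n ω|
        ≤ ∑ _n ∈ I, 4 * |κ| ^ 3 * υ ^ 3 / ((Module.finrank ℝ E : ℝ) - 1) ^ 2 * c ^ 3 :=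
          Finset.sum_le_sum fun n _ =>
            abs_loLocalTerm_add_germ_le hU0 hUadj hd κ S₀ hυ he m hc0 hc hg n ω (T := T)
      _ = ρ := by rw [Finset.sum_const, nsmul_eq_mul]
  -- the same bound after corridor averaging and for the means
  set Dfun : (Λ → sphere (0 : E) 1) → ℝ := fun ω => h ω + c ^ 2 / 2 * V ω with hD
  have hDc : Continuous Dfun := hhc.add (continuous_const.mul hVc)
  have hAD : ∀ ω, |coordAvg (uniformSphere (volume : Measure E)) C Dfun ω| ≤ ρ :=
    fun ω => abs_coordAvg_le_of_abs_le _ C hgerm ω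
  have hmD : |∫ ω, Dfun ω ∂μ| ≤ ρ := by
    have hm := norm_integral_le_of_norm_le_const (μ := μ) (f := Dfun) (C := ρ)
      (ae_of_all _ fun ω => by rw [Real.norm_eq_abs]; exact hgerm ω)
    rwa [hμ, probReal_univ, mul_one, Real.norm_eq_abs, ← hμ] at hm
  -- linearity of `A_C` and of the mean
  have hAlin : ∀ ω, coordAvg (uniformSphere (volume : Measure E)) C Dfun ω =
      coordAvg (uniformSphere (volume : Measure E)) C h ω +
        c ^ 2 / 2 * coordAvg (uniformSphere (volume : Measure E)) C V ω := by
    intro ω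
    have hcV : Continuous (fun ω : Λ → sphere (0 : E) 1 => c ^ 2 / 2 * V ω) := continuous_const.mul hVc
    rw [hD, coordAvg_add _ C hhc hcV]
    have hm : coordAvg (uniformSphere (volume : Measure E)) C (fun ω => c ^ 2 / 2 * V ω) ω =
        c ^ 2 / 2 * coordAvg (uniformSphere (volume : Measure E)) C V ω :=
      coordAvg_mul_left _ C (Φ := fun _ => c ^ 2 / 2) (H := V) (fun _ _ => rfl) ω
    rw [hm]
  have hmlin : ∫ ω, Dfun ω ∂μ = (∫ ω, h ω ∂μ) + c ^ 2 / 2 * ∫ ω, V ω ∂μ := by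
    have hi1 : Integrable h μ := integrable_pi_of_continuous _ hhc
    have hi2 : Integrable (fun ω => c ^ 2 / 2 * V ω) μ := (integrable_pi_of_continuous _ hVc).const_mul _
    rw [hD, integral_add hi1 hi2, integral_const_mul]
  -- pointwise: `(c²/2)|A_C V − ∫V| − 2ρ ≤ |A_C h − ∫h|`
  have hpt : ∀ ω, c ^ 2 / 2 * |coordAvg (uniformSphere (volume : Measure E)) C V ω - ∫ ω', V ω' ∂μ| - 2 * ρ ≤
      |coordAvg (uniformSphere (volume : Measure E)) C h ω - ∫ ω', h ω' ∂μ| := by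
    intro ω
    have hc2 : 0 ≤ c ^ 2 / 2 := by positivity
    have key : c ^ 2 / 2 * (coordAvg (uniformSphere (volume : Measure E)) C V ω - ∫ ω', V ω' ∂μ) =
        (coordAvg (uniformSphere (volume : Measure E)) C Dfun ω - ∫ ω', Dfun ω' ∂μ) -
          (coordAvg (uniformSphere (volume : Measure E)) C h ω - ∫ ω', h ω' ∂μ) := by
      rw [hAlin ω, hmlin]; ring
    have h3 : |c ^ 2 / 2 * (coordAvg (uniformSphere (volume : Measure E)) C V ω - ∫ ω', V ω' ∂μ)| ≤
        (ρ + ρ) + |coordAvg (uniformSphere (volume : Measure E)) C h ω - ∫ ω', h ω' ∂μ| := by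
      rw [key]
      refine (abs_sub _ _).trans (add_le_add ((abs_sub _ _).trans (add_le_add (hAD ω) hmD)) le_rfl)
    rw [abs_mul, abs_of_nonneg hc2] at h3
    linarith
  -- integrate
  have hPi : Integrable (fun ω => |coordAvg (uniformSphere (volume : Measure E)) C h ω - ∫ ω', h ω' ∂μ|) μ :=
    integrable_pi_of_continuous _ ((continuous_coordAvg _ C hhc).sub continuous_const).abs
  have hQi : Integrable (fun ω => |coordAvg (uniformSphere (volume : Measure E)) C V ω - ∫ ω', V ω' ∂μ|) μ :=
    integrable_pi_of_continuous _ ((continuous_coordAvg _ C hVc).sub continuous_const).abs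
  have hQi' : Integrable (fun ω => c ^ 2 / 2 *
      |coordAvg (uniformSphere (volume : Measure E)) C V ω - ∫ ω', V ω' ∂μ|) μ := hQi.const_mul _
  have hLi : Integrable (fun ω => c ^ 2 / 2 *
      |coordAvg (uniformSphere (volume : Measure E)) C V ω - ∫ ω', V ω' ∂μ| - 2 * ρ) μ :=
    hQi'.sub (integrable_const _)
  have hmono := integral_mono hLi hPi hpt
  have h2ρ : Integrable (fun _ : Λ → sphere (0 : E) 1 => 2 * ρ) μ := integrable_const _
  rw [integral_sub hQi' h2ρ, integral_const_mul, integral_const, smul_eq_mul, hμ, probReal_univ,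
    one_mul, ← hμ] at hmono
  simpa only [hV, hh, hv, hρ] using hmono

end Block

/-! ## §3 The floor with the static germ -/

section Final

variable [MeasurableSpace E] [BorelSpace E] [Nontrivial E] {U : Λ → Λ → (E →L[ℝ] E)} {T : ℝ}

/-- **THE EXTENSIVE FLOOR WITH THE STATIC GERM.**  In the setting of
`sum_log_one_add_sq_sub_le_klDiv_map_loFlow`, with the STATIC block terms `V_j = Σ_{n∈I_j} v_n`
(`I_j = {n : ball(n) meets B_j}`) and `s_j = ∫|A_C V_j − ∫V_j dπ̄| dπ̄`:
`Σ_{j∈T} log(1 + (max 0 ((c²/2)s_j − 2|I_j|(4|κ|³υ³/(d−1)²)c³))²/8) − |Λ|·(12κ²υ²/(d−1))·c²·τ_m(c)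
  ≤ KL((Φ_{0→c})_*π̄ ‖ e^{−cS}π̄/Z_c)` — the only model input left is the flow-free `s_j`. -/
theorem sum_log_one_add_sq_germ_sub_le_klDiv_map_loFlow (hU0 : ∀ n, U n n = 0)
    (hUadj : ∀ m n (v w : E), ⟪U m n v, w⟫ = ⟪v, U n m w⟫) (hd : 2 ≤ Module.finrank ℝ E)
    (κ S₀ : ℝ) {υ : ℝ} (hυ : ∀ k, ∑ m, ‖U k m‖ ≤ υ) {c : ℝ} (hc0 : 0 ≤ c) (hc : c ≤ |T| + 1)
    {e : Λ → E} (he : ∀ n, ‖e n‖ = 1) (m : ℕ)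
    {g : Λ → (Λ → sphere (0 : E) 1) → ℝ}
    (hg : ∀ n ω, g n ω = -∫ u in (0 : ℝ)..c, u * (2 * κ ^ 2 / ((Module.finrank ℝ E : ℝ) - 1) *
      ‖tangentKick (localField U n (sphereTDFlow (G := fun _ : ℝ => loFlowAction κ S₀ U)
          (contDiff_const_family (contDiff_loFlowAction U κ S₀)) T 0 u
          ((nball (fun k => insert k (couplingNbhd U k)) (m + 1) n).piecewise
            (fun i => ((ω i : sphere (0 : E) 1) : E)) e)))
        (sphereTDFlow (G := fun _ : ℝ => loFlowAction κ S₀ U)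
          (contDiff_const_family (contDiff_loFlowAction U κ S₀)) T 0 u
          ((nball (fun k => insert k (couplingNbhd U k)) (m + 1) n).piecewise
            (fun i => ((ω i : sphere (0 : E) 1) : E)) e) n)‖ ^ 2))
    {J : Type*} (Tb : Finset J) (B : J → Finset Λ)
    (hB : ∀ j ∈ Tb, ∀ j' ∈ Tb, j ≠ j' → Disjoint (B j) (B j'))
    (hsep : ∀ n, ∀ j ∈ Tb, ∀ j' ∈ Tb,
      ¬ Disjoint (nball (fun k => insert k (couplingNbhd U k)) (m + 1) n) ↑(B j) →
      ¬ Disjoint (nball (fun k => insert k (couplingNbhd U k)) (m + 1) n) ↑(B j') → j = j') :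
    ∑ j ∈ Tb, Real.log (1 + (max 0 (c ^ 2 / 2 *
        (∫ ω, |coordAvg (uniformSphere (volume : Measure E)) (Finset.univ \ Tb.biUnion B)
          (fun ω => ∑ n ∈ Finset.univ.filter (fun n =>
            ¬ Disjoint (nball (fun k => insert k (couplingNbhd U k)) (m + 1) n) ↑(B j)),
            2 * κ ^ 2 / ((Module.finrank ℝ E : ℝ) - 1) *
              ‖tangentKick (localField U n (fun i => ((ω i : sphere (0 : E) 1) : E))) (ω n : E)‖ ^ 2) ω -
          ∫ ω', (∑ n ∈ Finset.univ.filter (fun n =>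
            ¬ Disjoint (nball (fun k => insert k (couplingNbhd U k)) (m + 1) n) ↑(B j)),
            2 * κ ^ 2 / ((Module.finrank ℝ E : ℝ) - 1) *
              ‖tangentKick (localField U n (fun i => ((ω' i : sphere (0 : E) 1) : E))) (ω' n : E)‖ ^ 2)
            ∂Measure.pi (fun _ : Λ => uniformSphere (volume : Measure E))|
          ∂Measure.pi (fun _ : Λ => uniformSphere (volume : Measure E))) -
        2 * ((Finset.univ.filter (fun n =>
            ¬ Disjoint (nball (fun k => insert k (couplingNbhd U k)) (m + 1) n) ↑(B j))).card *
          (4 * |κ| ^ 3 * υ ^ 3 / ((Module.finrank ℝ E : ℝ) - 1) ^ 2 * c ^ 3)))) ^ 2 / 8) -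
      Fintype.card Λ * (12 * κ ^ 2 * υ ^ 2 / ((Module.finrank ℝ E : ℝ) - 1) * c ^ 2 *
        (2 * Real.exp (3 * |κ| * υ / ((Module.finrank ℝ E : ℝ) - 1) * c) *
          (3 * |κ| * υ / ((Module.finrank ℝ E : ℝ) - 1) * c) ^ (m + 1) / ((m + 1)! : ℝ))) ≤
      (klDiv (Measure.map (sphereTDFlowMap (G := fun _ : ℝ => loFlowAction κ S₀ U)
          (contDiff_const_family (contDiff_loFlowAction U κ S₀)) T 0 c)
          (Measure.pi (fun _ : Λ => uniformSphere (volume : Measure E))))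
        ((Measure.pi (fun _ : Λ => uniformSphere (volume : Measure E))).tilted
          fun ω => -(c * esAction κ S₀ U (fun m => (ω m : E))))).toReal := by
  refine le_trans ?_
    (sum_log_one_add_sq_sub_le_klDiv_map_loFlow hU0 hUadj hd κ S₀ hυ hc0 hc he m hg Tb B hB hsep (T := T))
  gcongr with j hj
  -- `max 0 b ≤ a_j` (the side goal `0 ≤ max 0 b` is discharged by `positivity`)
  refine max_le (integral_nonneg fun ω => abs_nonneg _) ?_
  exact germ_le_blockFluctuation hU0 hUadj hd κ S₀ hυ he m hc0 hc hg _ _ (T := T)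

end Final

end Summit.Ventures.LatticeQCDFlow.Exactness

end
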